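import Summits.ValiantsHypothesis.ValiantsHypothesis.Theorems.BarrierLeverChowCubeReduction
import Summits.ValiantsHypothesis.ValiantsHypothesis.Theses.BarrierLever

/-!
# Route BarrierLever — items 20195 / 20172: the CUBE REDUCTION door (arbitrary columns ⇐ down-closed)

Helper file (`--supports stmt-ValiantsHypothesis-20195`; cell valiant-natproofs, rung V4, 𝒟-side of
door (c); seat val-np-p2 gen 8).  Closes NO item; definition-free; imports the core file
`…ChowCubeReduction` (`exists_chowFactors_of_closedColumns`) and the route file (decls by name).

* `chow_hit_of_downClosedColumns` — rows `u : Fin r → Finset (Fin h)` ARBITRARY, columns `w`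
  injective: if for EVERY injective DOWN-CLOSED column family `δ : Fin r → Finset (Fin h)` (each
  `δ j - c`, `c ∈ δ j`, is again some `δ j'`) some product `g` of `h` affine forms has
  `det[coeff_{E (u i) (δ j)} ∏ g] ≠ 0`, then `(u, w)` is Chow-hit by `h + h` affine forms
  (`g` and cube-type factors `s_c + y_c`).
* `chowHitsThinRowPartitionMinors_of_downClosed` — item 20195 `ChowHitsThinRowPartitionMinors`
  follows from its restriction to DOWN-CLOSED column families with `h` (not `h + h`) forms:
  «eventually in `h`, every thin-row layout `(u, δ)` with `δ` injective and down-closed admits a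
  product `g` of `h` affine forms with `det[coeff_{E (u i) (δ j)} g] ≠ 0`» ⇒ the item, BY NAME.
* `chowHitsPartitionMinors_of_downClosed` — the same for item 20172 `ChowHitsPartitionMinors`
  (arbitrary rows).
Down-closed families of size `r` consist of sets of size `≤ log₂ r`; for the numerics on the reduced
statement see the core file's docstring.

WHAT THIS IS NOT: doors only; items 20195 / 20172 / 19717 stay open; nothing on crux
stmt-ValiantsHypothesis-14610 or on `VP` versus `VNP`.
-/

set_option linter.dupNamespace false

namespace Summit.ValiantsHypothesis.ValiantsHypothesis.Theorems.BarrierLever.ChowCube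

open Finset MvPolynomial

variable {h r : ℕ}

/-! ## 5. The door: arbitrary columns from down-closed columns -/

/-- **CUBE REDUCTION (door for items 20195 / 20172).**  Rows `u` arbitrary, columns `w` injective.
If for EVERY injective, DOWN-CLOSED column family `δ : Fin r → Finset (Fin h)` (every `δ j - c`,
`c ∈ δ j`, is again some `δ j'`) some product `g` of `h` affine forms has
`det[coeff_{E (u i) (δ j)} ∏ g] ≠ 0`, then the layout `(u, w)` is Chow-hit: some product of `h + h`
affine forms (`g` and cube-type factors `s_c + y_c`) has `det[coeff_{E (u i) (w j)} ∏ ℓ] ≠ 0`. -/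
theorem chow_hit_of_downClosedColumns (u w : Fin r → Finset (Fin h)) (hw : Function.Injective w)
    (hDC : ∀ δ : Fin r → Finset (Fin h), Function.Injective δ →
      (∀ j, ∀ c ∈ δ j, ∃ j', δ j' = (δ j).erase c) →
      ∃ g : Fin h → MvPolynomial (Fin (h + h)) ℂ, (∀ k, (g k).totalDegree ≤ 1) ∧
        (Matrix.of fun i j : Fin r => coeff
          (∑ a ∈ u i, Finsupp.single (Fin.castAdd h a) 1 +
            ∑ c ∈ δ j, Finsupp.single (Fin.natAdd h c) 1) (∏ k, g k)).det ≠ 0) :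
    ∃ ℓ : Fin (h + h) → MvPolynomial (Fin (h + h)) ℂ, (∀ q, (ℓ q).totalDegree ≤ 1) ∧
      (Matrix.of fun i j : Fin r => coeff
        (∑ a ∈ u i, Finsupp.single (Fin.castAdd h a) 1 + ∑ c ∈ w j, Finsupp.single (Fin.natAdd h c) 1)
        (∏ q, ℓ q)).det ≠ 0 := by
  classical
  have hDC' : ∀ δ : Fin r → Finset (Fin h), Function.Injective δ →
      (∀ c ∈ (∅ : Finset (Fin h)) ∪ Finset.univ, ∀ j, c ∈ δ j → ∃ j', δ j' = (δ j).erase c) →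
      ∃ g : Fin h → MvPolynomial (Fin (h + h)) ℂ, (∀ k, (g k).totalDegree ≤ 1) ∧
        (Matrix.of fun i j : Fin r => coeff
          (∑ a ∈ u i, Finsupp.single (Fin.castAdd h a) 1 +
            ∑ c ∈ δ j, Finsupp.single (Fin.natAdd h c) 1) (∏ k, g k)).det ≠ 0 :=
    fun δ hδ hcl => hDC δ hδ fun j c hc => hcl c (by simp) j hc
  obtain ⟨g, hg, s, hdet⟩ := exists_chowFactors_of_closedColumns u h Finset.univ ∅ w hw
    (fun c hc => absurd hc (Finset.notMem_empty c)) hDC'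
  refine ⟨Fin.append g (fun c => C (s c) + X (Fin.natAdd h c)), fun q => ?_, ?_⟩
  · induction q using Fin.addCases with
    | left k =>
      rw [Fin.append_left]
      exact hg k
    | right c =>
      rw [Fin.append_right]
      exact totalDegree_C_add_X_natAdd_le (s c) c
  · have hprod : (∏ q, Fin.append g (fun c => C (s c) + X (Fin.natAdd h c)) q) =
        (∏ k, g k) * ∏ c, (C (s c) + X (Fin.natAdd h c)) := by
      rw [Fin.prod_univ_add]
      simp only [Fin.append_left, Fin.append_right]
    rw [hprod]
    exact hdet

/-! ## 6. Item-level doors (route decls by name) -/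

/-- **Item 20195 from its down-closed restriction.**  If, eventually in `h`, every THIN-row layout
with an injective DOWN-CLOSED column family is hit by a product of `h` affine forms, then
`ChowHitsThinRowPartitionMinors` (item stmt-ValiantsHypothesis-20195) holds. -/
theorem chowHitsThinRowPartitionMinors_of_downClosed
    (hDC : ∃ h₀ : ℕ, ∀ h : ℕ, h₀ ≤ h → ∀ (r : ℕ) (u δ : Fin r → Finset (Fin h)),
      Function.Injective u → Function.Injective δ → (∀ i, (u i).card ≤ 2) →
      (∀ j, ∀ c ∈ δ j, ∃ j', δ j' = (δ j).erase c) →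
      ∃ g : Fin h → MvPolynomial (Fin (h + h)) ℂ, (∀ k, (g k).totalDegree ≤ 1) ∧
        (Matrix.of fun i j : Fin r => MvPolynomial.coeff
          (∑ a ∈ u i, Finsupp.single (Fin.castAdd h a) 1 +
            ∑ c ∈ δ j, Finsupp.single (Fin.natAdd h c) 1) (∏ k, g k)).det ≠ 0) :
    Summit.ValiantsHypothesis.ValiantsHypothesis.Theses.BarrierLever.ChowHitsThinRowPartitionMinors := by
  obtain ⟨h₀, H⟩ := hDC
  refine ⟨h₀, fun h hh r u w hu hw hthin => ?_⟩
  exact chow_hit_of_downClosedColumns u w hw fun δ hδ hδcl => H h hh r u δ hu hδ hthin hδcl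

/-- **Item 20172 from its down-closed restriction.**  If, eventually in `h`, every layout with an
injective DOWN-CLOSED column family is hit by a product of `h` affine forms, then
`ChowHitsPartitionMinors` (item stmt-ValiantsHypothesis-20172) holds. -/
theorem chowHitsPartitionMinors_of_downClosed
    (hDC : ∃ h₀ : ℕ, ∀ h : ℕ, h₀ ≤ h → ∀ (r : ℕ) (u δ : Fin r → Finset (Fin h)),
      Function.Injective u → Function.Injective δ →
      (∀ j, ∀ c ∈ δ j, ∃ j', δ j' = (δ j).erase c) →
      ∃ g : Fin h → MvPolynomial (Fin (h + h)) ℂ, (∀ k, (g k).totalDegree ≤ 1) ∧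
        (Matrix.of fun i j : Fin r => MvPolynomial.coeff
          (∑ a ∈ u i, Finsupp.single (Fin.castAdd h a) 1 +
            ∑ c ∈ δ j, Finsupp.single (Fin.natAdd h c) 1) (∏ k, g k)).det ≠ 0) :
    Summit.ValiantsHypothesis.ValiantsHypothesis.Theses.BarrierLever.ChowHitsPartitionMinors := by
  obtain ⟨h₀, H⟩ := hDC
  refine ⟨h₀, fun h hh r u w hu hw => ?_⟩
  exact chow_hit_of_downClosedColumns u w hw fun δ hδ hδcl => H h hh r u δ hu hδ hδcl

/-! ## 7. Cube factors on a coordinate subset: the general door (appended, val-np-p2 g8) -/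

/-- **GENERAL CUBE DOOR (cube factors on a coordinate set `K`, `m` inner forms, `m + |K| = h + h`).**
Rows `u` arbitrary, columns `w` injective.  If every injective column family `δ` that is closed under
removing the coordinates of `K` is hit by some product of `m` affine forms, then `(u, w)` is Chow-hit by
`h + h` affine forms (the `m` inner forms and the cube-type factors `s_c + y_c`, `c ∈ K`).  With
`K = univ, m = h` this is `chow_hit_of_downClosedColumns`; with `K = univ ∖ {c₀}`, `m = h + 1` it is
the TWO-FIBRE door needed for the pure-pair × star layouts (where `h` inner forms cannot suffice). -/
theorem chow_hit_of_closedColumns (u w : Fin r → Finset (Fin h)) (hw : Function.Injective w)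
    (K : Finset (Fin h)) (m : ℕ) (hm : m + K.card = h + h)
    (hDC : ∀ δ : Fin r → Finset (Fin h), Function.Injective δ →
      (∀ c ∈ K, ∀ j, c ∈ δ j → ∃ j', δ j' = (δ j).erase c) →
      ∃ g : Fin m → MvPolynomial (Fin (h + h)) ℂ, (∀ k, (g k).totalDegree ≤ 1) ∧
        (Matrix.of fun i j : Fin r => coeff
          (∑ a ∈ u i, Finsupp.single (Fin.castAdd h a) 1 +
            ∑ c ∈ δ j, Finsupp.single (Fin.natAdd h c) 1) (∏ k, g k)).det ≠ 0) :
    ∃ ℓ : Fin (h + h) → MvPolynomial (Fin (h + h)) ℂ, (∀ q, (ℓ q).totalDegree ≤ 1) ∧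
      (Matrix.of fun i j : Fin r => coeff
        (∑ a ∈ u i, Finsupp.single (Fin.castAdd h a) 1 + ∑ c ∈ w j, Finsupp.single (Fin.natAdd h c) 1)
        (∏ q, ℓ q)).det ≠ 0 := by
  classical
  have hDC' : ∀ δ : Fin r → Finset (Fin h), Function.Injective δ →
      (∀ c ∈ (∅ : Finset (Fin h)) ∪ K, ∀ j, c ∈ δ j → ∃ j', δ j' = (δ j).erase c) →
      ∃ g : Fin m → MvPolynomial (Fin (h + h)) ℂ, (∀ k, (g k).totalDegree ≤ 1) ∧
        (Matrix.of fun i j : Fin r => coeff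
          (∑ a ∈ u i, Finsupp.single (Fin.castAdd h a) 1 +
            ∑ c ∈ δ j, Finsupp.single (Fin.natAdd h c) 1) (∏ k, g k)).det ≠ 0 :=
    fun δ hδ hcl => hDC δ hδ fun c hc => hcl c (by simpa using hc)
  obtain ⟨g, hg, s, hdet⟩ := exists_chowFactors_of_closedColumns u m K ∅ w hw
    (fun c hc => absurd hc (Finset.notMem_empty c)) hDC'
  -- enumerate `K` and package the `m + |K|` forms as `h + h` forms
  set e : Fin K.card ≃ {c // c ∈ K} := K.equivFin.symm with he
  set F : Fin (m + K.card) → MvPolynomial (Fin (h + h)) ℂ :=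
    Fin.append g (fun k => C (s (e k : Fin h)) + X (Fin.natAdd h (e k : Fin h))) with hF
  refine ⟨fun q => F (Fin.cast hm.symm q), fun q => ?_, ?_⟩
  · show (F (Fin.cast hm.symm q)).totalDegree ≤ 1
    generalize Fin.cast hm.symm q = q'
    rw [hF]
    induction q' using Fin.addCases with
    | left k => rw [Fin.append_left]; exact hg k
    | right k => rw [Fin.append_right]; exact totalDegree_C_add_X_natAdd_le _ _
  · have hprod : (∏ q : Fin (h + h), F (Fin.cast hm.symm q)) =
        (∏ k, g k) * ∏ c ∈ K, (C (s c) + X (Fin.natAdd h c)) := by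
      rw [show (∏ q : Fin (h + h), F (Fin.cast hm.symm q)) = ∏ q : Fin (m + K.card), F q from
        Fintype.prod_equiv (finCongr hm.symm) _ _ (fun q => rfl), hF, Fin.prod_univ_add]
      simp only [Fin.append_left, Fin.append_right]
      congr 1
      rw [← Finset.prod_coe_sort K]
      exact Fintype.prod_equiv e _ _ (fun k => rfl)
    rw [hprod]
    exact hdet

end Summit.ValiantsHypothesis.ValiantsHypothesis.Theorems.BarrierLever.ChowCube
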